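import Summits.BirchSwinnertonDyer.BirchSwinnertonDyer.Theorems.PrintCFramBottomClassIndexLawFiveLeGenusInternalStrippedIdentityRoad
import Summits.BirchSwinnertonDyer.BirchSwinnertonDyer.Theorems.PrintCFramBottomClassIndexLawFiveLeGenusInternalRoutingClassDatum
import Summits.BirchSwinnertonDyer.BirchSwinnertonDyer.Theorems.PrintCFramBottomClassIndexLawFiveLeBernoulliKummerDictionaryNumerics
import Summits.BirchSwinnertonDyer.Rank1Residual.X12.O11.RouteUTwistCM
import Summits.BirchSwinnertonDyer.Rank1Residual.X12.O11.RouteUTraceForm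
import Mathlib.Tactic.NormNum.LegendreSymbol
import HarnessLib

/-!
# Route `PrintCFram`, crux C2 `BottomClassIndexLawFiveLe` (stmt-BirchSwinnertonDyer-20372), line `eisenstein-resource-bdp-line`:
# (GI-S, file 2) THE `f = 13` STRIPPING AT `p = 7` — the class datum `(χ₁₃, k = 5)` of `49a1^{(13)}`, its CO-REGULARITY
# `B_{2,χ₁₃} = 4` IN THE KERNEL, and the identity-road end state for the rank-one twists `49a1^{(13·d_K)}` (class `−39 = (−3)·13`)

Cell `bsd-print-cfram`, width seat `bsd-line-cfram-p1-w7` g8 (prover); helper `--supports` stmt-BirchSwinnertonDyer-20372; THEOREMS ONLY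
(0 definitions, 0 named facts, 0 `sorry`); nothing registered is touched. BSD is not proved by any of this; no summit statement is proved by
this seat; no registered stub is closed.

WHAT. File 1 (`…GenusInternalStrippedIdentityRoad`, p705925) gives `BSDp W p` for the rank-one twist `W ≅ V^{(d_K)}` of a CO-REGULAR base
class member `V` over any imaginary quadratic Heegner field `K` of `N_V`, from the REGULARITY of the rank-one class — the «internal road
`D ∣ e*`, base `A^{(e*/D)}`» of LEAD g14 (06:58:09Z) at every `D`, `ℚ(√−3)` and `ℚ(i)` included. Here the first proper stripping of the
`p = 7` window is made explicit: `f = 13`.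

* §1 `classDatum_of_smul_eq_twist_cm7_thirteen` — every elliptic `V` with `C • V = 49a1^{(13)}` carries the class datum `(m, χ, ε, k) =
  (13, χ₁₃, (·|13), 5)`: `χ₁₃` primitive quadratic with values the Jacobi symbols `(a|13)`, trace form `a_ℓ(V) ≡ (ℓ|13)(ℓ⁵ + ℓ²) (mod 7)`,
  good reduction off `7·13` (w2 g14's `GenusInternalRouting.exists_krizLiDataDict_of_coprime_twist` at `e = 13 ≡ 1 (mod 4)` over
  bsd-cm's `RouteU.lFunction_cm7_mod_seven` / `hasGoodReductionAtPrime_cm7`).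
* §2 `coregular_thirteen` — **CO-REGULARITY OF `13` AT `7` IN THE KERNEL: `¬ ‖(2 : ℚ₇)⁻¹·B_{2,χ₁₃}‖ ≤ 7⁻¹`** for every `ℚ₇`-valued
  character mod `13` with values `(a|13)`: w8 g3's numeric criterion `KummerDictionary.classFactor_le_inv_iff_dvd_num` reads it as
  `7 ∤ num(∑_{a<13} (a|13)·13·B₂(a/13))`, and the sum is `B_{2,χ₁₃} = 4` (`natCast_mul_genBernoulliCoeff_two`; quadratic residues
  `{1,3,4,9,10,12}` mod `13`; `(351 − 299)/13 = 4`) — w8 g9 (c)'s `B_{2,χ₁₃}/2 = 2`.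
* §3 `bsdp_twist_of_twist_cm7_thirteen_identityRoad` — END STATE: for `V` a globally minimal model of `49a1^{(13)}` of conductor `N`, `K`
  imaginary quadratic with the Heegner hypothesis for `N` (`7` and `13` split), Kronecker character `ε_K`, a primitive `χε` of level prime
  to `7` agreeing with `(·|13)·ε_K` off finitely many primes which is REGULAR, `¬ ‖(5:ℚ₇)⁻¹·B_{5,χε}‖ ≤ 7⁻¹` (for `K = ℚ(√−3)`: `χε = χ_{−39}`,
  the class's own `hreg` in `stub_seedOffExc`), a level-`N` parametrisation datum with `7 ∤ c` and its Heegner point: **`BSDp W 7` for every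
  globally minimal `W` with `C • W = V^{(d_K)}` of analytic rank one** (class `−39` at `d_K = −3`), granted Kriz–Li Thm. 1.20, GZ + Kolyvagin
  at `(N, V, K)`, GZK, modularity, GZ I.(7.3), Cassels–Tate, Burungale–Flach Cor. 2. `§3'` the same for `W` presented as
  `C • W = 49a1^{(13·d_K)}` (`quadraticTwist_quadraticTwist`, `quadraticTwist_smul`).

HONEST FRAMING: per-class bookkeeping; what stays displayed for class `−39` is exactly what the `cm7` identity road displays for the
`χ_{e*}(7) = +1` classes (Heegner hypothesis of the stripping field, the Manin datum at level `N_V = 49·13²`, the named facts) plus the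
class's regularity; the CO-regularity is discharged here. beyond-print theorem: NO. References: [KrizLi2019] Thm. 1.20, §2; [Washington1997]
Thm. 5.11, Cor. 5.13; [Lang1990] Ch. 2 §2 B 7; [Cox2013] §1.C; [SilvermanAEC2009] X.5; crux STATUS w8 g9 06:50:20Z (c), LEAD g14 06:58:09Z.
-/

set_option autoImplicit false
-- `…BirchSwinnertonDyer.BirchSwinnertonDyer.Theorems…` is the problem's mandated namespace (D-0017).
set_option linter.dupNamespace false

noncomputable section

open scoped Classical NumberTheorySymbols

open WeierstrassCurve NumberField DirichletCharacter
  Literature.NumberTheory.EllipticCurves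
  Literature.NumberTheory.EllipticCurves.ModularForms
  Literature.NumberTheory.EllipticCurves.KrizLi2019
  Literature.NumberTheory.LFunctions
  Literature.NumberTheory.EllipticCurves.Rank1Residual
  Literature.NumberTheory.EllipticCurves.Rank1Residual.Typed
  Summit.BirchSwinnertonDyer.Rank1Residual
  Summit.BirchSwinnertonDyer.Rank1Residual.X12.O11
  Summit.BirchSwinnertonDyer.BirchSwinnertonDyer.Theorems
  Summit.BirchSwinnertonDyer.BirchSwinnertonDyer.Theorems.PrintCFram

namespace Summit.BirchSwinnertonDyer.BirchSwinnertonDyer.Theorems.PrintCFram.GenusInternal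

/-! ## §1. The class datum of `49a1^{(13)}`: `(m, χ, ε, k) = (13, χ₁₃, (·|13), 5)` -/

/-- **The class datum of (any model of) `49a1^{(13)}` at `7`.** For every elliptic `V/ℚ` with `C • V = cm7^{(13)}`: a primitive quadratic
`ℚ₇`-valued character `χ` mod `13` with values the Jacobi symbols `(a|13)`, the trace form `a_ℓ(V) ≡ (ℓ|13)·(ℓ⁵ + ℓ²) (mod 7)` at every prime
`ℓ ≠ 7`, and good reduction at every prime `ℓ ∉ {7, 13}` — w2 g14's twist dictionary at `e = 13 ≡ 1 (mod 4)` over bsd-cm's trace form of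
`X₀(49)` (`a_ℓ ≡ ℓ² + ℓ⁵`). The exponent is `k = 5` (`χ₁₃` is even, so `χ₁₃·ω⁵` is the odd member of the pair).
[cite: KrizLi2019, §2 (p. 12)] [cite: Cox2013, §1.C Lemma 1.14] [cite: SilvermanAEC2009, X.5 Prop. 5.4] -/
theorem classDatum_of_smul_eq_twist_cm7_thirteen (V : WeierstrassCurve ℚ) [V.IsElliptic]
    (hV : ∃ C : VariableChange ℚ, C • V = cm7.quadraticTwist ((13 : ℤ) : ℚ)) :
    ∃ χ : DirichletCharacter ℚ_[7] 13, χ.IsPrimitive ∧ χ.IsQuadratic ∧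
      (∀ a : ℕ, χ (a : ZMod 13) = ((J((a : ℤ) | 13) : ℤ) : ℚ_[7])) ∧
      (∀ ℓ : ℕ, ℓ.Prime → ℓ ≠ 7 →
        ((V.LFunction ℓ : ℤ) : ZMod 7) = ((J((ℓ : ℤ) | 13) : ℤ) : ZMod 7) * ((ℓ : ZMod 7) ^ 5 + (ℓ : ZMod 7) ^ (7 - 5))) ∧
      (∀ ℓ : ℕ, (hℓ : ℓ.Prime) → ℓ ≠ 7 → ¬ ℓ ∣ 13 → (haveI := Fact.mk hℓ; V.HasGoodReductionAtPrime ℓ)) := by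
  have hbase : ∀ (ℓ : ℕ) [Fact ℓ.Prime], ℓ ≠ 7 → (cm7.LFunction ℓ : ZMod 7) = (ℓ : ZMod 7) ^ 5 + (ℓ : ZMod 7) ^ 2 :=
    fun ℓ _ h7 => by rw [RouteU.lFunction_cm7_mod_seven ℓ h7, add_comm]
  obtain ⟨m, hm, χ, ε, -, hχ, hχq, hε, -, htr, hgood, hdict⟩ :=
    GenusInternalRouting.exists_krizLiDataDict_of_coprime_twist (p := 7) (by norm_num) cm7 5 2
      (fun q _ h => RouteU.hasGoodReductionAtPrime_cm7 q h) hbase V V (isIsogenous_self V) (e := 13)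
      (Int.prime_iff_natAbs_prime.mpr (by norm_num)).squarefree (by norm_num) hV
  rcases hdict with ⟨-, hm13, hεJ⟩ | ⟨h4, -, -⟩
  swap
  · norm_num at h4
  have hm' : m = 13 := by rw [hm13]; rfl
  subst hm'
  refine ⟨χ, hχ, hχq, fun a => by rw [hε a, hεJ a]; rfl, fun ℓ hℓ h7 => ?_, hgood⟩
  rw [htr ℓ hℓ h7, hεJ ℓ]
  rfl

/-! ## §2. Co-regularity of `13` at `7`: `B_{2,χ₁₃} = 4`, a `7`-adic unit -/

/-- **`∑_{a<13} (a|13)·13·B₂(a/13) = B_{2,χ₁₃} = 4`** (`13·B₂(a/13) = a²/13 − a + 13/6`; the quadratic residues mod `13` are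
`{1, 3, 4, 9, 10, 12}`; `Σ_{QR} a² − Σ_{NR} a² = 351 − 299 = 52 = 4·13`, the linear and constant terms cancel for the even character).
[cite: Lang1990, Ch. 2 §2, formula B 7 (k = 2)] -/
theorem sum_jacobiSym_thirteen_mul_genBernoulliCoeff_two :
    ∑ a ∈ Finset.range 13, ((J((a : ℤ) | 13) : ℤ) : ℚ) * genBernoulliCoeff (7 - 5) 13 a = 4 := by
  haveI : NeZero (13 : ℕ) := ⟨by norm_num⟩
  have hc : ∀ c : ℕ, genBernoulliCoeff (7 - 5) 13 c = ((c : ℚ) ^ 2 - (13 : ℚ) * c + (13 : ℚ) ^ 2 / 6) / 13 := by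
    intro c
    rw [eq_div_iff (by norm_num : (13 : ℚ) ≠ 0), mul_comm]
    exact natCast_mul_genBernoulliCoeff_two (N := 13) c
  simp only [Finset.sum_range_succ, Finset.sum_range_zero, hc]
  norm_num [jacobiSym.mod_left]

/-- **CO-REGULARITY OF `13` AT `7`, registry currency: `¬ ‖((7 − 5 : ℕ) : ℚ₇)⁻¹ · B_{7−5,χ}‖ ≤ ((7:ℕ):ℝ)⁻¹`** for every `ℚ₇`-valued character `χ`
mod `13` with values `(a|13)` — w8 g3's numeric criterion `KummerDictionary.classFactor_le_inv_iff_dvd_num` (`m = 13 ⊥ 7`, `k = 5`) and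
`§2`'s value `4`, `7 ∤ 4`. This is the hypothesis `hcoh` of file 1's `bsdp_twist_of_classDatum_coregular_identityRoad` for the base
`49a1^{(13)}` (its class factor `B_{1,(χ₁₃ω⁵)⁻¹} ≡ B_{2,χ₁₃}/2 = 2`). [cite: Washington1997, Thm. 5.11 and Cor. 5.13] [cite: KrizLi2019, Thm. 1.20 (p. 8)] -/
theorem coregular_thirteen (χ : DirichletCharacter ℚ_[7] 13)
    (hχ : ∀ a : ℕ, χ (a : ZMod 13) = ((J((a : ℤ) | 13) : ℤ) : ℚ_[7])) :
    ¬ ‖((7 - 5 : ℕ) : ℚ_[7])⁻¹ * generalizedBernoulli (7 - 5) χ‖ ≤ ((7 : ℕ) : ℝ)⁻¹ := by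
  haveI : NeZero (13 : ℕ) := ⟨by norm_num⟩
  rw [KummerDictionary.classFactor_le_inv_iff_dvd_num (p := 7) (by norm_num) χ (fun a => J((a : ℤ) | 13)) hχ
    (k := 5) (by norm_num) (by norm_num), sum_jacobiSym_thirteen_mul_genBernoulliCoeff_two]
  norm_num

/-! ## §3. END STATE: the rank-one twists `49a1^{(13·d_K)}` by the identity road, co-regularity discharged -/

/-- **`BSD(W,7)` FOR THE RANK-ONE TWISTS `W ≅ V^{(d_K)}`, `V ∼ 49a1^{(13)}`, BY THE STRIPPED IDENTITY ROAD — co-regularity discharged.**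
Data: `V/ℚ` globally minimal with `C • V = cm7^{(13)}`, of conductor `N`; `K` imaginary quadratic with the Heegner hypothesis for `N`
(`7` and `13` split in `K`: e.g. `K = ℚ(√−3)`, the stripping `−39 = (−3)·13` of LEAD g13 §4's window), Kronecker character `ε_K`; a
primitive `χε` of level `c ⊥ 7` agreeing with `(ℓ|13)·ε_K(ℓ)` at all primes `ℓ ∤ N₁`, REGULAR: `¬ ‖(5:ℚ₇)⁻¹·B_{5,χε}‖ ≤ 7⁻¹` (the
rank-one class's own `hreg`); a level-`N` parametrisation datum `Dt` with `7 ∤ c(Dt)`, Heegner data `(H, ι, P)`, `ιp : K → ℚ₇`. Then,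
granted Kriz–Li Thm. 1.20, Gross–Zagier and Kolyvagin at `(N, V, K)`, GZK, modularity, GZ I.(7.3), Cassels–Tate and Burungale–Flach
Cor. 2: **`BSDp W 7`** for every globally minimal `W` with `C • W = V^{(d_K)}` and `ord_{s=1} L(W,s) = 1`. Proof: file 1's
`bsdp_twist_of_classDatum_coregular_identityRoad` at the class datum of §1 with `hcoh := coregular_thirteen`; CM / CM-ramification of `V`
by bsd-cm's `RouteU.hasCM_of_twist_cm7` / `cmFieldDiscrOfJ_of_twist_cm7`. CONDITIONAL on the named facts; closes no stub.
[cite: KrizLi2019, Thm. 1.20 (pp. 7–8), §2 (p. 11)] [cite: GrossZagier1986, Thm. I.(6.3) and I.(7.3)] [cite: Cassels1962ArithmeticIV]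
[cite: BurungaleFlach2024, Cor. 2] [cite: Miller2011LMS, Def. 1.1] [cite: Washington1997, Thm. 5.11 and Cor. 5.13] -/
theorem bsdp_twist_of_twist_cm7_thirteen_identityRoad
    (hKL : thm120_padicLogHeegner_unit_of_bernoulli)
    (hCT : exists_casselsTate_pairing (K := ℚ)) (hGZK : rank_eq_analyticRank_of_analyticRank_le_one)
    (hmod : hasEntireLFunction_rat) (hGZ73 : GrossZagier1986_thm_I_7_3) (hBF : bsdTriple_of_hasCM_of_L_one_ne_zero)
    (V : WeierstrassCurve ℚ) [V.IsElliptic] [V.IsGloballyMinimal]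
    (hV : ∃ C : VariableChange ℚ, C • V = cm7.quadraticTwist ((13 : ℤ) : ℚ))
    {N : ℕ} [NeZero N] (hN : V.conductorNorm ℤ = N)
    (K : Type) [Field K] [NumberField K] (hK : IsImaginaryQuadratic K) (hHN : SatisfiesHeegnerHypothesis N K)
    (hGZ : gross_zagier N V K) (hKo : kolyvagin N V K)
    (Dt : ModularParametrizationData V N) (H : HeegnerDatum N (NumberField.discr K)) (ι : K →+* ℂ) (ιp : K →+* ℚ_[7])
    (P : (V.baseChange K).toAffine.Point)
    (hP : WeierstrassCurve.Affine.Point.map ι.toRatAlgHom P = heegnerPointComplex Dt H)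
    (hc : ¬ (7 : ℤ) ∣ Dt.c)
    (εK : DirichletCharacter ℚ_[7] (NumberField.discr K).natAbs) (hεK : IsKroneckerCharacterOf K εK)
    -- regularity of the rank-one class `((·|13)·ε_K)~`
    {c : ℕ} [NeZero c] (hc7 : c.Coprime 7) (χε : DirichletCharacter ℚ_[7] c) (hχε : χε.IsPrimitive) {N₁ : ℕ} (hN₁ : N₁ ≠ 0)
    (hval : ∀ ℓ : ℕ, ℓ.Prime → ¬ ℓ ∣ N₁ →
      χε (ℓ : ZMod c) = ((J((ℓ : ℤ) | 13) : ℤ) : ℚ_[7]) * εK (ℓ : ZMod (NumberField.discr K).natAbs))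
    (hreg : ¬ ‖(5 : ℚ_[7])⁻¹ * generalizedBernoulli 5 χε‖ ≤ (7 : ℝ)⁻¹)
    -- the rank-one twist
    (W : WeierstrassCurve ℚ) [W.IsElliptic] [W.IsGloballyMinimal]
    (hW : ∃ C : VariableChange ℚ, C • W = V.quadraticTwist (NumberField.discr K : ℚ)) (hr : W.analyticRank = 1) :
    BSDp W 7 := by
  have h13 : (13 : ℤ) ≠ 0 := by norm_num
  have hCM : V.HasCM := RouteU.hasCM_of_twist_cm7 V h13 hV
  have hram : CMRamified V 7 := by
    rw [CMRamified, RouteU.cmFieldDiscrOfJ_of_twist_cm7 V h13 hV]; norm_num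
  obtain ⟨χ, hχ, hχq, hχJ, htr, hgood⟩ := classDatum_of_smul_eq_twist_cm7_thirteen V hV
  haveI : NeZero (13 : ℕ) := ⟨by norm_num⟩
  -- parity: `χ₁₃(−1) = (12|13) = 1`, so `χ₁₃·ω⁵` is odd
  have hpar : χ (-1) * (-1) ^ 5 = -1 := by
    have e : ((12 : ℕ) : ZMod 13) = -1 := by decide
    rw [← e, hχJ 12]
    norm_num [jacobiSym.mod_left]
  have hreg' : ¬ ‖((5 : ℕ) : ℚ_[7])⁻¹ * generalizedBernoulli 5 χε‖ ≤ (7 : ℝ)⁻¹ := by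
    simpa only [Nat.cast_ofNat] using hreg
  exact bsdp_twist_of_classDatum_coregular_identityRoad (p := 7) hKL hCT hGZK hmod hGZ73 hBF V hCM hram (by norm_num) hN K hK hHN
    hGZ hKo Dt H ι ιp P hP (by exact_mod_cast hc) χ hχ hχq (by norm_num) (fun a => J((a : ℤ) | 13))
    (fun ℓ _ _ => hχJ ℓ) (k := 5) (by norm_num) (by norm_num) hpar htr hgood (coregular_thirteen χ hχJ) εK hεK hc7 χε hχε hN₁
    (fun ℓ hℓ hℓN => by rw [hval ℓ hℓ hℓN, hχJ ℓ]) hreg' W hW hr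

/-- **The same with `W` presented as a twist of `X₀(49)` itself: `C • W = 49a1^{(13·d_K)}`** (for `K = ℚ(√−3)`: the class `e* = −39`).
`V^{(d_K)} = (C_V⁻¹ • 49a1^{(13)})^{(d_K)}` is a change of variables of `49a1^{(13·d_K)}` (`quadraticTwist_smul`,
`quadraticTwist_quadraticTwist`). [cite: SilvermanAEC2009, X.5 Prop. 5.4 and Cor. 5.4.1] [cite: KrizLi2019, Thm. 1.20 (pp. 7–8)] -/
theorem bsdp_of_smul_eq_twist_cm7_thirteen_mul_discr_identityRoad
    (hKL : thm120_padicLogHeegner_unit_of_bernoulli)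
    (hCT : exists_casselsTate_pairing (K := ℚ)) (hGZK : rank_eq_analyticRank_of_analyticRank_le_one)
    (hmod : hasEntireLFunction_rat) (hGZ73 : GrossZagier1986_thm_I_7_3) (hBF : bsdTriple_of_hasCM_of_L_one_ne_zero)
    (V : WeierstrassCurve ℚ) [V.IsElliptic] [V.IsGloballyMinimal]
    (hV : ∃ C : VariableChange ℚ, C • V = cm7.quadraticTwist ((13 : ℤ) : ℚ))
    {N : ℕ} [NeZero N] (hN : V.conductorNorm ℤ = N)
    (K : Type) [Field K] [NumberField K] (hK : IsImaginaryQuadratic K) (hHN : SatisfiesHeegnerHypothesis N K)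
    (hGZ : gross_zagier N V K) (hKo : kolyvagin N V K)
    (Dt : ModularParametrizationData V N) (H : HeegnerDatum N (NumberField.discr K)) (ι : K →+* ℂ) (ιp : K →+* ℚ_[7])
    (P : (V.baseChange K).toAffine.Point)
    (hP : WeierstrassCurve.Affine.Point.map ι.toRatAlgHom P = heegnerPointComplex Dt H)
    (hc : ¬ (7 : ℤ) ∣ Dt.c)
    (εK : DirichletCharacter ℚ_[7] (NumberField.discr K).natAbs) (hεK : IsKroneckerCharacterOf K εK)
    {c : ℕ} [NeZero c] (hc7 : c.Coprime 7) (χε : DirichletCharacter ℚ_[7] c) (hχε : χε.IsPrimitive) {N₁ : ℕ} (hN₁ : N₁ ≠ 0)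
    (hval : ∀ ℓ : ℕ, ℓ.Prime → ¬ ℓ ∣ N₁ →
      χε (ℓ : ZMod c) = ((J((ℓ : ℤ) | 13) : ℤ) : ℚ_[7]) * εK (ℓ : ZMod (NumberField.discr K).natAbs))
    (hreg : ¬ ‖(5 : ℚ_[7])⁻¹ * generalizedBernoulli 5 χε‖ ≤ (7 : ℝ)⁻¹)
    (W : WeierstrassCurve ℚ) [W.IsElliptic] [W.IsGloballyMinimal]
    (hW : ∃ C : VariableChange ℚ, C • W = cm7.quadraticTwist ((13 : ℤ) * NumberField.discr K : ℚ))
    (hr : W.analyticRank = 1) : BSDp W 7 := by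
  -- `V^{(d_K)}` is a change of variables of `49a1^{(13 d_K)}`
  obtain ⟨CV, hCV⟩ := hV
  obtain ⟨CW, hCW⟩ := hW
  have hVd : V.quadraticTwist (NumberField.discr K : ℚ) =
      (⟨CV⁻¹.u, (NumberField.discr K : ℚ) * CV⁻¹.r, 0, 0⟩ : VariableChange ℚ) •
        cm7.quadraticTwist ((13 : ℤ) * NumberField.discr K : ℚ) := by
    have hV' : V = CV⁻¹ • cm7.quadraticTwist ((13 : ℤ) : ℚ) := by rw [← hCV, inv_smul_smul]
    rw [hV', quadraticTwist_smul, quadraticTwist_quadraticTwist]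
  have hW' : ∃ C : VariableChange ℚ, C • W = V.quadraticTwist (NumberField.discr K : ℚ) := by
    refine ⟨(⟨CV⁻¹.u, (NumberField.discr K : ℚ) * CV⁻¹.r, 0, 0⟩ : VariableChange ℚ) * CW, ?_⟩
    rw [mul_smul, hCW, hVd]
  exact bsdp_twist_of_twist_cm7_thirteen_identityRoad hKL hCT hGZK hmod hGZ73 hBF V ⟨CV, hCV⟩ hN K hK hHN hGZ hKo Dt H ι ιp P hP hc
    εK hεK hc7 χε hχε hN₁ hval hreg W hW' hr

end Summit.BirchSwinnertonDyer.BirchSwinnertonDyer.Theorems.PrintCFram.GenusInternal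

end
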